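import Literature.Analysis.FluidPDE.SereginSverakAxisymmetric
import Literature.Analysis.FluidPDE.NSBoundedSuitableEnergy
import HarnessLib

/-!
# Seregin–Šverák 2009, Remark 3.4: discharge of `SereginSverak2009.SuitableOfBounded`

Sibling proof file of `SereginSverakAxisymmetric.lean`, which vendors Remark 3.4 of G. Seregin,
V. Šverák, *On Type I singularities of the local axi-symmetric solutions of the Navier–Stokes
equations*, Comm. PDE 34 (2009) 171–201 = arXiv:0804.1803 (page references to the arXiv
version) as the named fact `SereginSverak2009.SuitableOfBounded`:

> **Remark 3.4.** Under the assumptions of Lemma 3.3, the pair `v` and `q` forms a suitable weak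
> solution to the Navier–Stokes equations in `Q`.

The assumptions of Lemma 3.3 (p. 9) are the standing ones of §3 (`v ∈ L₃(Q)`, `q ∈ L_{3/2}(Q)`
solving the Navier–Stokes system in `Q = 𝒞 × ]-1, 0[` in the sense of distributions), axial
symmetry, and (r2): `v ∈ L_∞(𝒞 × ]-1, -a²[)` for each `0 < a < 1`. No proof is printed; the
reason is the one the paper gives on p. 6 for the analogous conditions (b8)–(b10): "the pair `v`
and `q` … is in fact a suitable weak solution … It is certainly true in `B × ]-1,-a²[` …", i.e.
essentially bounded distributional solutions are suitable — the classical fact proved in the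
tree as `isSuitableWeakSolutionOn_of_bounded` (`FluidPDE/NSBoundedSuitableEnergy`: the weak
gradient as the strong `L²` limit of mollified gradients by a Caccioppoli–Cauchy estimate, and
the local energy inequality by mollification; Caffarelli–Kohn–Nirenberg 1982, §2; Serrin 1962).

The fact `SuitableOfBounded` renders the conclusion by the accepted LOCAL notion
`IsSuitableWeakSolutionOn (parCylOpens 0 1) 1 0 u p` (classes on compact subsets of the open
cylinder, local energy inequality for test functions compactly supported in it). Every compact
subset of `Q` lies in some `Q_n = Q ∩ {t < -1/(n+2)}`, on which `u` is essentially bounded by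
(r2); hence `isSuitableWeakSolutionOn_of_bounded` on each `Q_n` and the accepted gluing theorem
`IsSuitableWeakSolutionOn.of_exhaustion` give the statement. Axial symmetry and `v ∈ L₃(Q)` are
not needed for this (weaker-than-printed, local) conclusion.

## Contents

* `SereginSverak2009.norm_lt_two_of_lt_one` — points of the unit spatial cylinder `𝒞` have norm
  `< 2` (so `Q` has finite measure);
* `SereginSverak2009.SuitableOfBounded_holds : SuitableOfBounded` — the discharge.

## References

* G. Seregin, V. Šverák, Comm. PDE 34 (2009) 171–201, arXiv:0804.1803: §2 p. 6 ((b8)–(b10) and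
  the sentence following them), §3 p. 9 (Lemma 3.3 (asl2), Remark 3.4 (asr3)).
  [`SereginSverak2009`]
* L. Caffarelli, R. Kohn, L. Nirenberg, CPAM 35 (1982), §2.
-/

noncomputable section

open MeasureTheory Set Function Filter Topology TopologicalSpace Metric
open scoped NNReal ENNReal

namespace Literature.Analysis.FluidPDE

namespace SereginSverak2009

/-- Points `x` with `|x'| < 1` and `|x₃| < 1` (the unit spatial cylinder `𝒞` of §3) satisfy
`‖x‖ < 2`, since `‖x‖² = |x'|² + x₃²`. [folklore] -/
theorem norm_lt_two_of_lt_one {x : EuclideanSpace ℝ (Fin 3)} (h1 : cylRadius x < 1) (h2 : |x 2| < 1) : ‖x‖ < 2 := by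
  have hsq : ‖x‖ ^ 2 = cylRadius x ^ 2 + x 2 ^ 2 := by
    rw [EuclideanSpace.norm_eq, Real.sq_sqrt (by positivity), cylRadius_sq]
    simp [Fin.sum_univ_three, sq_abs]
  have hr0 : 0 ≤ cylRadius x := cylRadius_nonneg x
  have h3 : ‖x‖ ^ 2 < 2 ^ 2 := by
    rw [hsq]
    have hx2 : x 2 ^ 2 < 1 := by
      have := abs_lt.1 h2
      nlinarith [this.1, this.2]
    nlinarith [hr0, h1, hx2]
  exact lt_of_pow_lt_pow_left₀ 2 (by norm_num) h3

/-- The unit space–time cylinder `Q = 𝒞 × ]-1, 0[` has finite measure (it is bounded). [folklore] -/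
theorem volume_parCyl_zero_one_lt_top : volume (parCyl 0 1 : Set (ℝ × EuclideanSpace ℝ (Fin 3))) < ∞ := by
  have hsub : parCyl 0 1 ⊆ Ioo (-1 : ℝ) 0 ×ˢ ball (0 : EuclideanSpace ℝ (Fin 3)) 2 := by
    intro z hz
    rw [mem_parCyl_zero] at hz
    refine ⟨⟨by linarith [hz.1.1], hz.1.2⟩, ?_⟩
    rw [mem_ball, dist_zero_right]
    exact norm_lt_two_of_lt_one hz.2.1 hz.2.2
  exact ((Bornology.IsBounded.prod (Metric.isBounded_Ioo (-1 : ℝ) 0) Metric.isBounded_ball).subset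
    hsub).measure_lt_top

/-- **Discharge of `SereginSverak2009.SuitableOfBounded` (Seregin–Šverák 2009, Remark 3.4).**
Under the standing assumptions of §3 with axial symmetry (`IsAxisymmetricLocalSolution`) and
(r2) (`IsBoundedAwayFromZero`: `v ∈ L_∞(𝒞 × ]-1,-a²[)` for every `0 < a < 1`), `(v, q)` is a
suitable weak solution in `Q = 𝒞 × ]-1, 0[` (accepted local notion `IsSuitableWeakSolutionOn`):
on each `Q_n = Q ∩ {t < -1/(n+2)}` the velocity is essentially bounded, so `(v, q)` is suitable
there by `isSuitableWeakSolutionOn_of_bounded` ("it is certainly true in `B × ]-1,-a²[`",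
loc. cit. p. 6), and the `Q_n` exhaust `Q` (`IsSuitableWeakSolutionOn.of_exhaustion`).
[cite: SereginSverak2009, Remark 3.4 (arXiv p. 9) with §2 p. 6] -/
theorem SuitableOfBounded_holds : SuitableOfBounded := by
  intro u p hsol hbd
  -- the truncated cylinders `Q_n = Q ∩ {t < -1/(n+2)}`
  have hopen : ∀ n : ℕ, IsOpen (parCyl 0 1 ∩ {z : ℝ × EuclideanSpace ℝ (Fin 3) | z.1 < -((n : ℝ) + 2)⁻¹}) := fun n =>
    (isOpen_parCyl 0 1).inter (isOpen_lt continuous_fst continuous_const)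
  set Qn : ℕ → Opens (ℝ × EuclideanSpace ℝ (Fin 3)) := fun n =>
    ⟨parCyl 0 1 ∩ {z : ℝ × EuclideanSpace ℝ (Fin 3) | z.1 < -((n : ℝ) + 2)⁻¹}, hopen n⟩ with hQn
  have hQnS : ∀ n, ((Qn n : Opens (ℝ × EuclideanSpace ℝ (Fin 3))) : Set (ℝ × EuclideanSpace ℝ (Fin 3))) =
      parCyl 0 1 ∩ {z : ℝ × EuclideanSpace ℝ (Fin 3) | z.1 < -((n : ℝ) + 2)⁻¹} := fun n => rfl
  have hle : ∀ n, Qn n ≤ parCylOpens 0 1 := fun n z hz => by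
    rw [← SetLike.mem_coe, hQnS] at hz
    exact hz.1
  have hmono : Monotone Qn := fun n m hnm z hz => by
    rw [← SetLike.mem_coe, hQnS] at hz ⊢
    have h : ((m : ℝ) + 2)⁻¹ ≤ ((n : ℝ) + 2)⁻¹ := by
      apply inv_anti₀ (by positivity)
      exact_mod_cast Nat.add_le_add_right hnm 2
    have hz2 : z.1 < -((n : ℝ) + 2)⁻¹ := hz.2
    refine ⟨hz.1, ?_⟩
    show z.1 < -((m : ℝ) + 2)⁻¹
    linarith
  have hcov : ∀ K ⊆ ((parCylOpens 0 1 : Opens (ℝ × EuclideanSpace ℝ (Fin 3))) : Set (ℝ × EuclideanSpace ℝ (Fin 3))), IsCompact K →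
      ∃ n, K ⊆ ((Qn n : Opens (ℝ × EuclideanSpace ℝ (Fin 3))) : Set (ℝ × EuclideanSpace ℝ (Fin 3))) := by
    intro K hKQ hK
    rcases K.eq_empty_or_nonempty with rfl | hne
    · exact ⟨0, empty_subset _⟩
    obtain ⟨z₀, hz₀, hmax⟩ := hK.exists_isMaxOn hne continuous_fst.continuousOn
    have hz₀Q : z₀ ∈ parCyl 0 1 := hKQ hz₀
    rw [mem_parCyl_zero] at hz₀Q
    have hneg : 0 < -z₀.1 := by linarith [hz₀Q.1.2]
    obtain ⟨n, hn⟩ := exists_nat_gt ((-z₀.1)⁻¹)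
    refine ⟨n, fun z hz => ?_⟩
    rw [hQnS]
    refine ⟨hKQ hz, ?_⟩
    have h1 : z.1 ≤ z₀.1 := hmax hz
    have h2 : ((n : ℝ) + 2)⁻¹ < -z₀.1 := by
      rw [inv_lt_comm₀ (by positivity) hneg]
      linarith
    show z.1 < -((n : ℝ) + 2)⁻¹
    linarith
  -- on each `Q_n` the pair is a bounded distributional solution, hence suitable
  have hsuit : ∀ n, IsSuitableWeakSolutionOn (Qn n) 1 0 u p := by
    intro n
    have hNS : IsDistributionalNSSolutionOn (Qn n) 1 0 u p :=
      IsDistributionalNSSolutionOn.mono_holds hsol.distributional (hle n)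
    have hfin : volume ((Qn n : Opens (ℝ × EuclideanSpace ℝ (Fin 3))) : Set (ℝ × EuclideanSpace ℝ (Fin 3))) < ∞ :=
      lt_of_le_of_lt (measure_mono (hle n)) volume_parCyl_zero_one_lt_top
    have hpn : ∫⁻ z in ((Qn n : Opens (ℝ × EuclideanSpace ℝ (Fin 3))) : Set (ℝ × EuclideanSpace ℝ (Fin 3))), ‖p z.1 z.2‖ₑ ^ (3 / 2 : ℝ) < ∞ :=
      lt_of_le_of_lt (lintegral_mono_set (hle n)) hsol.pressure_L32
    -- the bound from (r2) with `a² = 1/(n+2)`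
    set a : ℝ := Real.sqrt (((n : ℝ) + 2)⁻¹) with ha
    have han : 0 < ((n : ℝ) + 2)⁻¹ := by positivity
    have ha2 : a ^ 2 = ((n : ℝ) + 2)⁻¹ := by rw [ha, Real.sq_sqrt han.le]
    have haI : a ∈ Ioo (0 : ℝ) 1 := by
      refine ⟨Real.sqrt_pos.2 han, ?_⟩
      rw [ha, Real.sqrt_lt' one_pos, one_pow]
      have h2 : (2 : ℝ) ≤ (n : ℝ) + 2 := by linarith [(Nat.cast_nonneg n : (0 : ℝ) ≤ n)]
      calc ((n : ℝ) + 2)⁻¹ ≤ (2 : ℝ)⁻¹ := inv_anti₀ two_pos h2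
        _ < 1 := by norm_num
    obtain ⟨Kb, hKb⟩ := hbd a haI
    have hM : ∀ᵐ z ∂(volume.restrict ((Qn n : Opens (ℝ × EuclideanSpace ℝ (Fin 3))) : Set (ℝ × EuclideanSpace ℝ (Fin 3)))),
        ‖u z.1 z.2‖ ≤ Kb := by
      have h1 : ∀ᵐ z ∂(volume.restrict ((Qn n : Opens (ℝ × EuclideanSpace ℝ (Fin 3))) : Set (ℝ × EuclideanSpace ℝ (Fin 3)))),
          z.1 < -a ^ 2 → ‖u z.1 z.2‖ ≤ Kb :=
        ae_restrict_of_ae_restrict_of_subset (hle n) hKb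
      have h2 : ∀ᵐ z ∂(volume.restrict ((Qn n : Opens (ℝ × EuclideanSpace ℝ (Fin 3))) : Set (ℝ × EuclideanSpace ℝ (Fin 3)))),
          z ∈ ((Qn n : Opens (ℝ × EuclideanSpace ℝ (Fin 3))) : Set (ℝ × EuclideanSpace ℝ (Fin 3))) :=
        ae_restrict_mem (Qn n).isOpen.measurableSet
      filter_upwards [h1, h2] with z hz hzm
      rw [hQnS] at hzm
      refine hz ?_
      rw [ha2]
      exact hzm.2
    exact isSuitableWeakSolutionOn_of_bounded one_pos hNS hfin hM hpn
  exact IsSuitableWeakSolutionOn.of_exhaustion hle hmono hcov hsuit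

end SereginSverak2009

end Literature.Analysis.FluidPDE
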